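import Literature.Analysis.FluidPDE.PassiveVectorTensorCubeDescentDecayApprox
import Literature.Analysis.FluidPDE.PassiveVectorTensorPropagatorBandKill
import HarnessLib

/-!
# Band kill for window propagators — best-approximation form of the carrier's spectral tail

Analysis/FluidPDE file (pure proof layer; no definitions, no named facts).  Same statements and proofs as
`PassiveVectorTensorPropagatorBandKill.IsPropagator.bandKill_of_divFree` / `bandKill`, with the slices of the carrier measured by their
sup-norm distance to SOME real trigonometric polynomial with frequencies in the cube `‖k‖_∞ ≤ nS − 2Δ` (`∃ t, IsConjSymm t ∧ …`) instead of
to their sharp Fourier truncations (cell note F-k3l-8): for `y ∈ L²` with Fourier coefficients vanishing on the ladder box,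
(i) `Σ_{|k| ≤ L'} |𝓕(U(s,s′)y)(k)|² ≤ x^{−2(J+1)} ‖y‖²`, (ii) `‖U(s,s′)y‖² ≤ (e^{−8π² lo L'²(s′−s)} + x^{−2(J+1)}) ‖y‖²`
(`IsPropagator.bandKill_of_divFree'`, `IsPropagator.bandKill'`).  Consumer: cell `ad-ideate`, K1L_D `stmt-AnomalousDissipation-27980`,
W3-E (ii) `stub_effectiveFrameEnergyL_bandKill`.
## Mathlib / tree search
Tree: `PassiveVectorTensorPropagatorBandKill` (the sharp version and the `L²` helpers `norm_sq_eq_integral_norm_sq`, `norm_toLp_sq_eq_integral`,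
`memLp_top_stLift_shift_window`), `PassiveVectorTensorCubeDescentDecayApprox.ae_integral_norm_sq_le_exp_add_leak'`, `PassiveVectorTensorPropagator`.
## References
* R. Temam, *Navier–Stokes Equations* (1984), Ch. III §1 Lemma 1.2. [`Temam1984`]
* R. J. DiPerna, P.-L. Lions, Invent. Math. 98 (1989), §II.1 Lemma II.1. [`DiPernaLions1989`] -/

noncomputable section

open MeasureTheory Set Filter Complex UnitAddTorus Function Finset
open scoped ENNReal InnerProductSpace ComplexConjugate Topology

namespace Literature.Analysis.FluidPDE

namespace Torus

variable {d : Type*} [Fintype d] [DecidableEq d]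
variable {T : ℝ} {𝔸 : Visc4 d} {lo hi : ℝ} {b : ℝ → UnitAddTorus d → EuclideanSpace ℝ d}
variable {U : ℝ → ℝ → (Lp (EuclideanSpace ℝ d) 2 (volume : Measure (UnitAddTorus d)) →L[ℝ]
  Lp (EuclideanSpace ℝ d) 2 (volume : Measure (UnitAddTorus d)))}

namespace IsPropagator


/-- **BAND KILL FOR THE WINDOW PROPAGATOR, divergence-free data — best-approximation form of the spectral tail** (F-k3l-8).  Carrier: bounded, with a.e. weakly divergence-free,
continuous, `Λ`-Lipschitz slices within `W n` of their Fourier truncations at radius `n S − 2Δ` (`n ≤ J + 1`); ladder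
`K₀, S, Δ, J` (`2Δ ≤ S`, `J S ≤ K₀`) with the LADDER CONDITION on the window `[s, s′]`; `L' ≤ K₀ − J S`.  For a weakly
divergence-free `y ∈ L²` whose Fourier coefficients vanish on the ladder box `‖k‖_∞ ≤ K₀ + S + 2Δ`:
(i) `Σ_{|k| ≤ L'} |𝓕(U(s,s′)y)(k)|² ≤ x^{−2(J+1)} ‖y‖²` and (ii) `‖U(s,s′)y‖² ≤ (e^{−8π² lo L'² (s′−s)} + x^{−2(J+1)}) ‖y‖²`.
[cite: Temam1984, Ch. III §1 Lemma 1.2] [cite: DiPernaLions1989, §II.1 Lemma II.1] -/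
theorem bandKill_of_divFree' (hU : IsPropagator T b 𝔸 U) (h𝔸 : NearIso 𝔸 lo hi) (hlo : 0 < lo)
    (hb : MemLp (FunctionSpaces.Torus.stLift b) ∞ (volume.restrict (Ioo 0 T ×ˢ univ)))
    (hbdiv : ∀ᵐ τ ∂(volume.restrict (Ioo 0 T)), FunctionSpaces.Torus.IsWeaklyDivFree (b τ))
    (hbc : ∀ᵐ τ ∂(volume.restrict (Ioo 0 T)), Continuous (b τ))
    {Λ : ℝ} (hΛ : 0 ≤ Λ)
    (hbL : ∀ᵐ τ ∂(volume.restrict (Ioo 0 T)), ∀ x y, ‖b τ x - b τ y‖ ≤ Λ * ‖FunctionSpaces.Torus.reprc (x - y)‖)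
    {K₀ S Δ J : ℕ} (hΔ : 0 < Δ) (hS : 2 * Δ ≤ S) (hJ : (J + 1) * S ≤ K₀ + S)
    {W : ℕ → ℝ} (hW0 : ∀ n, 0 ≤ W n)
    (hW : ∀ᵐ τ ∂(volume.restrict (Ioo 0 T)), ∀ n, 1 ≤ n → n ≤ J + 1 → ∃ t : (d → ℤ) → EuclideanSpace ℂ d,
      FunctionSpaces.Torus.IsConjSymm t ∧
        ∀ x, ‖b τ x - FunctionSpaces.Torus.realTrigPoly (FunctionSpaces.Torus.cubeSupp d (n * S - 2 * Δ)) t x‖ ≤ W n)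
    {s s' x : ℝ} (hs : 0 ≤ s) (hss' : s < s') (hs'T : s' ≤ T) (hx : 1 ≤ x)
    (hladder : 4 * Real.pi * (K₀ + 2 * Δ) * (s' - s) * x *
      (2 * (Fintype.card d) ^ 2 * Λ / Δ + Fintype.card d * ∑ n ∈ Finset.range (J + 1), W (n + 1) * x ^ (n + 1)) ≤ 1)
    {L' : ℕ} (hL' : L' ≤ FunctionSpaces.Torus.rungHeight K₀ S (J + 1))
    (y : Lp (EuclideanSpace ℝ d) 2 (volume : Measure (UnitAddTorus d)))
    (hy : FunctionSpaces.Torus.IsWeaklyDivFree (y : UnitAddTorus d → EuclideanSpace ℝ d))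
    (hyoff : ∀ k ∈ FunctionSpaces.Torus.ladderSupp d K₀ S Δ,
      mFourierCoeff (FunctionSpaces.EuclideanSpace.complexify ∘ (y : UnitAddTorus d → EuclideanSpace ℝ d)) k = 0) :
    (∑ k ∈ FunctionSpaces.Torus.freqBall L', ‖mFourierCoeff (FunctionSpaces.EuclideanSpace.complexify ∘
        ((U s s' y : Lp (EuclideanSpace ℝ d) 2 volume) : UnitAddTorus d → EuclideanSpace ℝ d)) k‖ ^ 2 ≤
        (x⁻¹ ^ (J + 1)) ^ 2 * ‖y‖ ^ 2) ∧
    ‖U s s' y‖ ^ 2 ≤ (Real.exp (-(8 * Real.pi ^ 2 * lo * (L' : ℝ) ^ 2 * (s' - s))) + (x⁻¹ ^ (J + 1)) ^ 2) * ‖y‖ ^ 2 := by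
  classical
  have hsT : s < T := hss'.trans_le hs'T
  set τ : ℝ := s' - s with hτdef
  have hτ : 0 < τ := sub_pos.2 hss'
  have hτT : τ ≤ T - s := by rw [hτdef]; linarith
  set ε2 : ℝ := (x⁻¹ ^ (J + 1)) ^ 2 with hε2
  set ρ : ℝ := 8 * Real.pi ^ 2 * lo * (L' : ℝ) ^ 2 with hρ
  have hε20 : 0 ≤ ε2 := sq_nonneg _
  have hym : MemLp (y : UnitAddTorus d → EuclideanSpace ℝ d) 2 volume := Lp.memLp y
  set w := windowSol h𝔸 hlo hb hbdiv hs hsT hym hy with hwdef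
  have hsol := windowSol_spec h𝔸 hlo hb hbdiv hs hsT hym hy
  -- the shifted carrier
  have hb' := memLp_top_stLift_shift_window (T := T) hb hs
  have hbc' : ∀ᵐ r ∂(volume.restrict (Ioo 0 (T - s))), Continuous (b (s + r)) :=
    ae_restrict_Ioo_comp_add_left (P := fun t => Continuous (b t)) hbc hs (by linarith)
  have hbL' : ∀ᵐ r ∂(volume.restrict (Ioo 0 (T - s))), ∀ x y, ‖b (s + r) x - b (s + r) y‖ ≤
      Λ * ‖FunctionSpaces.Torus.reprc (x - y)‖ :=
    ae_restrict_Ioo_comp_add_left (P := fun t => ∀ x y, ‖b t x - b t y‖ ≤ Λ * ‖FunctionSpaces.Torus.reprc (x - y)‖) hbL hs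
      (by linarith)
  have hW' : ∀ᵐ r ∂(volume.restrict (Ioo 0 (T - s))), ∀ n, 1 ≤ n → n ≤ J + 1 → ∃ t : (d → ℤ) → EuclideanSpace ℂ d,
      FunctionSpaces.Torus.IsConjSymm t ∧
        ∀ x, ‖b (s + r) x - FunctionSpaces.Torus.realTrigPoly (FunctionSpaces.Torus.cubeSupp d (n * S - 2 * Δ)) t x‖ ≤ W n :=
    ae_restrict_Ioo_comp_add_left (P := fun t' => ∀ n, 1 ≤ n → n ≤ J + 1 → ∃ t : (d → ℤ) → EuclideanSpace ℂ d,
      FunctionSpaces.Torus.IsConjSymm t ∧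
        ∀ x, ‖b t' x - FunctionSpaces.Torus.realTrigPoly (FunctionSpaces.Torus.cubeSupp d (n * S - 2 * Δ)) t x‖ ≤ W n) hW hs (by linarith)
  -- the flat bound along `w`
  have hflat := hsol.ae_integral_norm_sq_le_exp_add_leak' h𝔸 hlo hym hy hb' hΔ hS hJ hyoff hbc' hΛ hbL' hW0 hW' hτ hτT hx
    hladder hL'
  -- representation of `U` by `w`
  have hrepr := hU.repr s hs hsT _ hym hy w hsol
  have hyLp : hym.toLp (y : UnitAddTorus d → EuclideanSpace ℝ d) = y := Lp.toLp_coeFn y hym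
  have hsub : Ioo 0 τ ⊆ Ioo 0 (T - s) := Ioo_subset_Ioo le_rfl hτT
  have hE0 : (∫ z, ‖(y : UnitAddTorus d → EuclideanSpace ℝ d) z‖ ^ 2) = ‖y‖ ^ 2 := (norm_sq_eq_integral_norm_sq y).symm
  -- a.e. `r ∈ (0,τ)`: the two bounds for `U s (s+r) y`, through the representative `w r`
  have hgood : ∀ᵐ r ∂(volume.restrict (Ioo 0 τ)), ∃ hm : MemLp (w r) 2 volume, hm.toLp (w r) = U s (s + r) y ∧
      (∑ k ∈ FunctionSpaces.Torus.freqBall L', ‖mFourierCoeff (FunctionSpaces.EuclideanSpace.complexify ∘ w r) k‖ ^ 2 ≤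
        ε2 * ‖y‖ ^ 2) ∧ ‖U s (s + r) y‖ ^ 2 ≤ (Real.exp (-(ρ * r)) + ε2) * ‖y‖ ^ 2 := by
    filter_upwards [hflat, ae_restrict_of_ae_restrict_of_subset hsub hrepr] with r hr hrep
    obtain ⟨hm, he⟩ := hrep
    rw [hyLp] at he
    refine ⟨hm, he, ?_, ?_⟩
    · rw [hE0] at hr; exact hr.1
    · have e1 : ‖U s (s + r) y‖ ^ 2 = ∫ z, ‖w r z‖ ^ 2 := by rw [← he]; exact norm_toLp_sq_eq_integral hm
      rw [e1, hρ]; rw [hE0] at hr; exact hr.2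
  -- ### (ii) the energy at the endpoint, through weak continuity tested against `U s s' y`
  have hcont : ∀ z : Lp (EuclideanSpace ℝ d) 2 (volume : Measure (UnitAddTorus d)),
      ContinuousOn (fun r => ⟪U s (s + r) y, z⟫_ℝ) (Icc 0 τ) := by
    intro z
    have hc := hU.continuousOn s hs hsT.le y z
    refine (hc.comp (continuous_const.add continuous_id).continuousOn ?_)
    intro r hr
    exact ⟨by linarith [hr.1], by rw [hτdef] at hr; linarith [hr.2]⟩
  have hsτ : s + τ = s' := by rw [hτdef]; ring
  have henergy : ‖U s s' y‖ ^ 2 ≤ (Real.exp (-(ρ * τ)) + ε2) * ‖y‖ ^ 2 := by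
    set A : ℝ := ‖U s s' y‖ with hAdef
    have hA0 : 0 ≤ A := norm_nonneg _
    set R : ℝ := (Real.exp (-(ρ * τ)) + ε2) * ‖y‖ ^ 2 with hRdef
    have hR0 : 0 ≤ R := by positivity
    set g : ℝ → ℝ := fun r => Real.sqrt ((Real.exp (-(ρ * r)) + ε2) * ‖y‖ ^ 2) * A with hgdef
    have hgc : ContinuousOn g (Icc 0 τ) := by
      refine ((Real.continuous_sqrt.comp ?_).mul continuous_const).continuousOn
      exact ((Real.continuous_exp.comp (continuous_const.mul continuous_id).neg).add continuous_const).mul continuous_const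
    have hfg : ∀ᵐ r ∂(volume.restrict (Ioo 0 τ)), ⟪U s (s + r) y, U s s' y⟫_ℝ ≤ g r := by
      filter_upwards [hgood] with r hr
      obtain ⟨_, _, _, h2⟩ := hr
      have h1 : ⟪U s (s + r) y, U s s' y⟫_ℝ ≤ ‖U s (s + r) y‖ * A := real_inner_le_norm _ _
      have h3 : ‖U s (s + r) y‖ ≤ Real.sqrt ((Real.exp (-(ρ * r)) + ε2) * ‖y‖ ^ 2) := by
        rw [← Real.sqrt_sq (norm_nonneg _)]; exact Real.sqrt_le_sqrt h2
      exact h1.trans (mul_le_mul_of_nonneg_right h3 hA0)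
    have hend := le_on_Icc_of_ae_le_of_continuousOn₂ hτ (hcont _) hgc hfg τ ⟨hτ.le, le_rfl⟩
    have hfτ : ⟪U s (s + τ) y, U s s' y⟫_ℝ = A ^ 2 := by rw [hsτ, hAdef]; exact real_inner_self_eq_norm_sq _
    simp only [hgdef] at hend
    rw [hfτ] at hend
    rcases hA0.eq_or_lt with hA | hApos
    · rw [← hA]; simpa using hR0
    · have h3 : A ≤ Real.sqrt R := by
        have : A * A ≤ Real.sqrt R * A := by rw [← sq]; exact hend
        exact le_of_mul_le_mul_right this hApos
      calc A ^ 2 ≤ Real.sqrt R ^ 2 := by gcongr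
        _ = R := Real.sq_sqrt hR0
  -- ### (i) the low modes at the endpoint, tested against the truncation of `U s s' y`
  set S₀ : Finset (d → ℤ) := FunctionSpaces.Torus.freqBall L' with hS₀
  have hS₀sym : ∀ k ∈ S₀, -k ∈ S₀ := FunctionSpaces.Torus.neg_mem_freqBall_of_mem
  set u' : UnitAddTorus d → EuclideanSpace ℝ d := ((U s s' y : Lp (EuclideanSpace ℝ d) 2 volume) : UnitAddTorus d → EuclideanSpace ℝ d)
    with hu'
  have hu'm : MemLp u' 2 volume := Lp.memLp _
  set c : (d → ℤ) → EuclideanSpace ℂ d := fun k => mFourierCoeff (FunctionSpaces.EuclideanSpace.complexify ∘ u') k with hc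
  have hcsym : FunctionSpaces.Torus.IsConjSymm c := FunctionSpaces.Torus.isConjSymm_mFourierCoeff (hu'm.integrable one_le_two)
  have hzm : MemLp (FunctionSpaces.Torus.realTrigPoly S₀ c) 2 volume := FunctionSpaces.Torus.memLp_realTrigPoly S₀ c 2
  set z : Lp (EuclideanSpace ℝ d) 2 (volume : Measure (UnitAddTorus d)) := hzm.toLp _ with hz
  set B2 : ℝ := ∑ k ∈ S₀, ‖c k‖ ^ 2 with hB2
  have hB20 : 0 ≤ B2 := Finset.sum_nonneg fun k _ => sq_nonneg _
  have hzn : ‖z‖ ^ 2 = B2 := by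
    rw [hz, norm_toLp_sq_eq_integral hzm, FunctionSpaces.Torus.integral_norm_sq_realTrigPoly hS₀sym hcsym]
  -- the pairing `⟪v, z⟫ = Σ_{k∈S₀} Re⟪𝓕v(k), c k⟫` for `v ∈ L²`
  have hpair : ∀ v : Lp (EuclideanSpace ℝ d) 2 (volume : Measure (UnitAddTorus d)),
      ⟪v, z⟫_ℝ = ∑ k ∈ S₀, (inner ℂ (mFourierCoeff (FunctionSpaces.EuclideanSpace.complexify ∘
        (v : UnitAddTorus d → EuclideanSpace ℝ d)) k) (c k)).re := by
    intro v
    rw [MeasureTheory.L2.inner_def, ← FunctionSpaces.Torus.integral_inner_realTrigPoly_right hS₀sym hcsym (Lp.memLp v)]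
    refine integral_congr_ae ?_
    filter_upwards [hzm.coeFn_toLp] with ξ hξ
    rw [hz] ; simp only [hξ]
  have hlow : B2 ≤ ε2 * ‖y‖ ^ 2 := by
    set g : ℝ → ℝ := fun _ => Real.sqrt (ε2 * ‖y‖ ^ 2) * Real.sqrt B2 with hgdef
    have hgc : ContinuousOn g (Icc 0 τ) := continuousOn_const
    have hfg : ∀ᵐ r ∂(volume.restrict (Ioo 0 τ)), ⟪U s (s + r) y, z⟫_ℝ ≤ g r := by
      filter_upwards [hgood] with r hr
      obtain ⟨hm, he, h1, _⟩ := hr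
      rw [hpair]
      -- the Fourier coefficients of `U s (s+r) y` are those of `w r`
      have hae : ((U s (s + r) y : Lp (EuclideanSpace ℝ d) 2 volume) : UnitAddTorus d → EuclideanSpace ℝ d) =ᵐ[volume] w r := by
        rw [← he]; exact hm.coeFn_toLp
      have e2 : ∀ k, mFourierCoeff (FunctionSpaces.EuclideanSpace.complexify ∘
          ((U s (s + r) y : Lp (EuclideanSpace ℝ d) 2 volume) : UnitAddTorus d → EuclideanSpace ℝ d)) k =
          mFourierCoeff (FunctionSpaces.EuclideanSpace.complexify ∘ w r) k := fun k =>
        FunctionSpaces.Torus.mFourierCoeff_congr_ae (hae.mono fun ξ hξ => by simp only [Function.comp_apply, hξ]) k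
      simp_rw [e2]
      calc ∑ k ∈ S₀, (inner ℂ (mFourierCoeff (FunctionSpaces.EuclideanSpace.complexify ∘ w r) k) (c k)).re
          ≤ ∑ k ∈ S₀, ‖mFourierCoeff (FunctionSpaces.EuclideanSpace.complexify ∘ w r) k‖ * ‖c k‖ :=
            Finset.sum_le_sum fun k _ => (Complex.re_le_norm _).trans (norm_inner_le_norm _ _)
        _ ≤ Real.sqrt (∑ k ∈ S₀, ‖mFourierCoeff (FunctionSpaces.EuclideanSpace.complexify ∘ w r) k‖ ^ 2) * Real.sqrt B2 :=
            Real.sum_mul_le_sqrt_mul_sqrt _ _ _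
        _ ≤ Real.sqrt (ε2 * ‖y‖ ^ 2) * Real.sqrt B2 :=
            mul_le_mul_of_nonneg_right (Real.sqrt_le_sqrt h1) (Real.sqrt_nonneg _)
    have hend := le_on_Icc_of_ae_le_of_continuousOn₂ hτ (hcont z) hgc hfg τ ⟨hτ.le, le_rfl⟩
    have hfτ : ⟪U s (s + τ) y, z⟫_ℝ = B2 := by
      rw [hsτ, hpair, hB2]
      refine Finset.sum_congr rfl fun k _ => ?_
      rw [← @inner_self_eq_norm_sq ℂ]
      rfl
    simp only [hgdef] at hend
    rw [hfτ] at hend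
    -- `B2 ≤ √(ε2‖y‖²) √B2` ⇒ `B2 ≤ ε2 ‖y‖²`
    rcases hB20.eq_or_lt with hB | hBpos
    · rw [← hB]; positivity
    · have hsq : Real.sqrt B2 * Real.sqrt B2 = B2 := Real.mul_self_sqrt hB20
      have hspos : 0 < Real.sqrt B2 := Real.sqrt_pos.2 hBpos
      have h3 : Real.sqrt B2 ≤ Real.sqrt (ε2 * ‖y‖ ^ 2) := by
        have : Real.sqrt B2 * Real.sqrt B2 ≤ Real.sqrt (ε2 * ‖y‖ ^ 2) * Real.sqrt B2 := by rw [hsq]; exact hend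
        exact le_of_mul_le_mul_right this hspos
      calc B2 = Real.sqrt B2 * Real.sqrt B2 := hsq.symm
        _ ≤ Real.sqrt (ε2 * ‖y‖ ^ 2) * Real.sqrt (ε2 * ‖y‖ ^ 2) :=
            mul_le_mul h3 h3 (Real.sqrt_nonneg _) (Real.sqrt_nonneg _)
        _ = ε2 * ‖y‖ ^ 2 := Real.mul_self_sqrt (by positivity)
  refine ⟨hlow, ?_⟩
  rw [hρ, hτdef] at henergy
  exact henergy

/-- **BAND KILL FOR THE WINDOW PROPAGATOR, all `L²` data — best-approximation form** (`U` factors through the Leray projection, a contraction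
acting modewise): under the hypotheses of `bandKill_of_divFree`, for every `y ∈ L²` whose Fourier coefficients vanish on
the ladder box, (i) `Σ_{|k| ≤ L'} |𝓕(U(s,s′)y)(k)|² ≤ x^{−2(J+1)} ‖y‖²` and (ii)
`‖U(s,s′)y‖² ≤ (e^{−8π² lo L'² (s′−s)} + x^{−2(J+1)}) ‖y‖²`. [cite: Temam1984, Ch. III §1 Lemma 1.2] [cite: DiPernaLions1989, §II.1 Lemma II.1] -/
theorem bandKill' (hU : IsPropagator T b 𝔸 U) (h𝔸 : NearIso 𝔸 lo hi) (hlo : 0 < lo)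
    (hb : MemLp (FunctionSpaces.Torus.stLift b) ∞ (volume.restrict (Ioo 0 T ×ˢ univ)))
    (hbdiv : ∀ᵐ τ ∂(volume.restrict (Ioo 0 T)), FunctionSpaces.Torus.IsWeaklyDivFree (b τ))
    (hbc : ∀ᵐ τ ∂(volume.restrict (Ioo 0 T)), Continuous (b τ))
    {Λ : ℝ} (hΛ : 0 ≤ Λ)
    (hbL : ∀ᵐ τ ∂(volume.restrict (Ioo 0 T)), ∀ x y, ‖b τ x - b τ y‖ ≤ Λ * ‖FunctionSpaces.Torus.reprc (x - y)‖)
    {K₀ S Δ J : ℕ} (hΔ : 0 < Δ) (hS : 2 * Δ ≤ S) (hJ : (J + 1) * S ≤ K₀ + S)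
    {W : ℕ → ℝ} (hW0 : ∀ n, 0 ≤ W n)
    (hW : ∀ᵐ τ ∂(volume.restrict (Ioo 0 T)), ∀ n, 1 ≤ n → n ≤ J + 1 → ∃ t : (d → ℤ) → EuclideanSpace ℂ d,
      FunctionSpaces.Torus.IsConjSymm t ∧
        ∀ x, ‖b τ x - FunctionSpaces.Torus.realTrigPoly (FunctionSpaces.Torus.cubeSupp d (n * S - 2 * Δ)) t x‖ ≤ W n)
    {s s' x : ℝ} (hs : 0 ≤ s) (hss' : s < s') (hs'T : s' ≤ T) (hx : 1 ≤ x)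
    (hladder : 4 * Real.pi * (K₀ + 2 * Δ) * (s' - s) * x *
      (2 * (Fintype.card d) ^ 2 * Λ / Δ + Fintype.card d * ∑ n ∈ Finset.range (J + 1), W (n + 1) * x ^ (n + 1)) ≤ 1)
    {L' : ℕ} (hL' : L' ≤ FunctionSpaces.Torus.rungHeight K₀ S (J + 1))
    (y : Lp (EuclideanSpace ℝ d) 2 (volume : Measure (UnitAddTorus d)))
    (hyoff : ∀ k ∈ FunctionSpaces.Torus.ladderSupp d K₀ S Δ,
      mFourierCoeff (FunctionSpaces.EuclideanSpace.complexify ∘ (y : UnitAddTorus d → EuclideanSpace ℝ d)) k = 0) :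
    (∑ k ∈ FunctionSpaces.Torus.freqBall L', ‖mFourierCoeff (FunctionSpaces.EuclideanSpace.complexify ∘
        ((U s s' y : Lp (EuclideanSpace ℝ d) 2 volume) : UnitAddTorus d → EuclideanSpace ℝ d)) k‖ ^ 2 ≤
        (x⁻¹ ^ (J + 1)) ^ 2 * ‖y‖ ^ 2) ∧
    ‖U s s' y‖ ^ 2 ≤ (Real.exp (-(8 * Real.pi ^ 2 * lo * (L' : ℝ) ^ 2 * (s' - s))) + (x⁻¹ ^ (J + 1)) ^ 2) * ‖y‖ ^ 2 := by
  set P := (divFreeL2 d).starProjection with hP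
  rw [hU.apply_eq_apply_starProjection s s' y]
  have hPoff : ∀ k ∈ FunctionSpaces.Torus.ladderSupp d K₀ S Δ,
      mFourierCoeff (FunctionSpaces.EuclideanSpace.complexify ∘
        ((P y : Lp (EuclideanSpace ℝ d) 2 (volume : Measure (UnitAddTorus d))) : UnitAddTorus d → EuclideanSpace ℝ d)) k = 0 := by
    intro k hk
    have h1 := norm_mFourierCoeff_starProjection_le y k
    rw [hyoff k hk, norm_zero] at h1
    exact norm_le_zero_iff.1 h1
  have h := hU.bandKill_of_divFree' h𝔸 hlo hb hbdiv hbc hΛ hbL hΔ hS hJ hW0 hW hs hss' hs'T hx hladder hL' (P y)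
    (isWeaklyDivFree_starProjection y) hPoff
  have hN : ‖P y‖ ^ 2 ≤ ‖y‖ ^ 2 := pow_le_pow_left₀ (norm_nonneg _) ((divFreeL2 d).norm_starProjection_apply_le y) 2
  have hε : 0 ≤ (x⁻¹ ^ (J + 1)) ^ 2 := sq_nonneg _
  have hc : 0 ≤ Real.exp (-(8 * Real.pi ^ 2 * lo * (L' : ℝ) ^ 2 * (s' - s))) + (x⁻¹ ^ (J + 1)) ^ 2 := by positivity
  exact ⟨h.1.trans (mul_le_mul_of_nonneg_left hN hε), h.2.trans (mul_le_mul_of_nonneg_left hN hc)⟩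

end IsPropagator

end Torus

end Literature.Analysis.FluidPDE

end
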